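import Summits.ValiantsHypothesis.ValiantsHypothesis.Theorems.RyserTripartitionPerLeTripartitionTables
import HarnessLib

/-!
# The column-subset dynamic programme for the permanent is syntactically multilinear

For the generic `n × n` matrix `X = (X_{r,c})`, the sub-permanents
`q(j, S) = Σ_{b : {r < j} ≃ S} ∏_{r < j} X_{r, b r}` (`|S| = j`) satisfy
`q(j+1, S') = Σ_{c ∈ S'} X_{j,c} · q(j, S' ∖ c)` (`subperm_succ`), each product joining the fresh row
`j` to the first `j` rows — DISJOINT syntactic supports. Running the recurrence over all `j`-sets
gives ONE plain fan-in-two SYNTACTICALLY MULTILINEAR gate list of at most `2 (n+1) 2^n` gates in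
which `q(n, univ) = per_n` is available (`tablesDP`, `exists_smCircuit_perPoly_dp`): the folklore
upper bound `smL(per_n) ≤ 2(n+1)·2^n` behind "Ryser / the column-subset DP are syntactically
multilinear circuits of size ~ n 2^n" (informal text of `RyserTripartition.MultilinearRyserOptimal`).

Consequence for the threshold dial of `Theorems.SmThreshold` (decomposition workshop
`decomp-valiant`, lens 6, gen 3): the two lowest rungs are DECIDED NEGATIVELY in the kernel —
`not_perSmHardExp_one` (= `¬ PerSmHardExp 1`, stated unfolded because `Theorems.SmThreshold` is a
theses-cone leaf) and `not_perSmHardExp_two` (= `¬ PerSmHardExp 2`; `2(2m+1)·4^m ≤ 4(m+1)^4·4^m`):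
exponential syntactically-multilinear hardness of `per_(mc)` at rate `4^m = 2^((2/c)·n)` is FALSE
for `c ≤ 2`; the open rungs are `c ≥ 3` (rate `< 2^n`).

HONEST FRAMING: an explicit folklore circuit and two refuted over-strong rungs; nothing here bears
on `VP ≠ VNP`, which is NOT proved. Plumbing: `SynAvail` (`SyntacticMultilinearExtension.lean`) and
the row expansion `sum_equiv_prod_eq_sum_erase` / list-sum helper `savail_list_sum` of the
`PerLeTripartition` files.

## References

* [Ryser1963] H. J. Ryser, *Combinatorial Mathematics*, Carus Monograph 14 (1963), Ch. 2 §5.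
* [RazYehudayoff2008] R. Raz, A. Yehudayoff, Comput. Complexity 17 (2008), §2.
* [Burgisser2000] P. Bürgisser, *Completeness and Reduction in Algebraic Complexity Theory*, Def. 2.1.
-/

-- layout Summits/ValiantsHypothesis/ValiantsHypothesis forces the duplicated namespace component
set_option linter.dupNamespace false

namespace Summit.ValiantsHypothesis.ValiantsHypothesis.Theorems.ColumnSubsetDP

open Finset MvPolynomial Literature.Computability.AlgebraicComplexity
  Literature.Computability.AlgebraicComplexity.ArithCircuit
  Literature.Computability.AlgebraicComplexity.SynAvail
open Literature.Barriers.ValiantsHypothesis (IsPlainGate)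
open Summit.ValiantsHypothesis.ValiantsHypothesis.Theorems.RyserTripartition
  (savail_list_sum sum_equiv_prod_eq_sum_erase)

variable {R : Type*} [CommSemiring R]

/-! ### The first `j` rows and the sub-permanents `q(j, S)` -/

/-- The first `j` rows of `Fin n`. [folklore] -/
def rowsLT (n j : ℕ) : Finset (Fin n) :=
  (Finset.univ : Finset (Fin n)).filter (fun r : Fin n => (r : ℕ) < j)

/-- The sub-permanent `q(j, S) = Σ_{b : {r < j} ≃ S} ∏_{r < j} X_{r, b r}` of the generic matrix on
the first `j` rows and the column set `S`. [cite: Ryser1963, Ch. 2 §5] -/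
noncomputable def subperm (R : Type*) [CommSemiring R] (n j : ℕ) (S : Finset (Fin n)) :
    MvPolynomial (Fin n × Fin n) R :=
  ∑ b : ↥(rowsLT n j) ≃ ↥S, ∏ p : ↥(rowsLT n j), X ((p : Fin n), ((b p : ↥S) : Fin n))

/-- Removing the row `j` from the first `j+1` rows gives the first `j` rows. [folklore] -/
theorem erase_rowsLT_succ {n j : ℕ} (hj : j < n) :
    (rowsLT n (j + 1)).erase ⟨j, hj⟩ = rowsLT n j := by
  ext r
  simp only [rowsLT, Finset.mem_erase, Finset.mem_filter, Finset.mem_univ, true_and, ne_eq,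
    Fin.ext_iff]
  omega

/-- The row `j` is among the first `j+1` rows. [folklore] -/
theorem mem_rowsLT_succ {n j : ℕ} (hj : j < n) : (⟨j, hj⟩ : Fin n) ∈ rowsLT n (j + 1) := by
  simp [rowsLT]

/-- The row `j` is NOT among the first `j` rows. [folklore] -/
theorem not_mem_rowsLT {n j : ℕ} (hj : j < n) : (⟨j, hj⟩ : Fin n) ∉ rowsLT n j := by
  simp [rowsLT]

/-- The allowed syntactic support `(first j rows) × (all columns)` grows with `j`. [folklore] -/
theorem rowsLT_prod_mono {n j j' : ℕ} (h : j ≤ j') :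
    rowsLT n j ×ˢ (Finset.univ : Finset (Fin n)) ⊆ rowsLT n j' ×ˢ (Finset.univ : Finset (Fin n)) := by
  refine Finset.product_subset_product_left (fun r hr => ?_)
  simp only [rowsLT, Finset.mem_filter, Finset.mem_univ, true_and] at hr ⊢
  omega

/-- **The recurrence** `q(j+1, S') = Σ_{c ∈ S'} X_{j,c} · q(j, S' ∖ c)` (expansion along the row `j`).
[cite: Ryser1963, Ch. 2 §5] -/
theorem subperm_succ {n j : ℕ} (hj : j < n) (S' : Finset (Fin n)) :
    subperm R n (j + 1) S' = ∑ c ∈ S', X (⟨j, hj⟩, c) * subperm R n j (S'.erase c) := by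
  unfold subperm
  rw [sum_equiv_prod_eq_sum_erase (fun p c => (X (p, c) : MvPolynomial (Fin n × Fin n) R)) _ S'
    (mem_rowsLT_succ hj), erase_rowsLT_succ hj]

/-- The empty sub-permanent is `1`. [folklore] -/
theorem subperm_zero (n : ℕ) : subperm R n 0 ∅ = 1 := by
  unfold subperm
  have hempty : rowsLT n 0 = ∅ := by ext r; simp [rowsLT]
  haveI : IsEmpty ↥(rowsLT n 0) := by rw [hempty]; infer_instance
  haveI : IsEmpty ↥(∅ : Finset (Fin n)) := by infer_instance
  rw [Fintype.sum_eq_single (Equiv.equivOfIsEmpty _ _)]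
  · simp
  · intro b hb; exact absurd (Subsingleton.elim _ _) hb

/-- The full sub-permanent is the permanent: `q(n, univ) = per_n`. [cite: Ryser1963, Ch. 2 §5] -/
theorem subperm_full (n : ℕ) :
    subperm R n n (Finset.univ : Finset (Fin n)) = perPoly (Fin n) R := by
  classical
  have hmem : ∀ r : Fin n, r ∈ rowsLT n n := fun r => by simp [rowsLT]
  let e : ↥(rowsLT n n) ≃ Fin n := Equiv.subtypeUnivEquiv hmem
  let e' : ↥(Finset.univ : Finset (Fin n)) ≃ Fin n := Equiv.subtypeUnivEquiv Finset.mem_univ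
  unfold subperm Literature.Computability.AlgebraicComplexity.perPoly
  rw [← Matrix.permanent_transpose]
  unfold Matrix.permanent
  refine Fintype.sum_equiv (Equiv.equivCongr e e') _ _ (fun b => ?_)
  refine Fintype.prod_equiv e _ _ (fun p => ?_)
  simp [Matrix.transpose_apply, Matrix.mvPolynomialX_apply, Equiv.equivCongr_apply_apply, e, e']

/-! ### One table entry, one stage, all stages -/

/-- **One table entry.** If all `q(j, S'')`, `|S''| = j`, are available with support in the first `j`
rows, then `2(j+1)` more gates make `q(j+1, S')` (`|S'| = j+1`) available with support in the first
`j+1` rows, keeping the list plain, fan-in-two and syntactically multilinear. [cite: RazYehudayoff2008, §2] -/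
theorem entry (n : ℕ) {j : ℕ} (hj : j < n) (S' : Finset (Fin n)) (hS' : S'.card = j + 1)
    (gs : List (Gate R (Fin n × Fin n)))
    (hgs : ∀ g ∈ gs, g.fanIn ≤ 2 ∧ IsPlainGate g)
    (hml : ∀ (i : ℕ) (args : List (Operand R (Fin n × Fin n))),
      gs[i]? = some (.prod args) →
      (args.map (operandVarSet (gateVarSets (gs.take i)))).Pairwise Disjoint)
    (havail : ∀ S'' : Finset (Fin n), S''.card = j →
      ∃ u : Operand R (Fin n × Fin n), u.RefsBelow gs.length ∧
        u.eval (gateValues gs) = subperm R n j S'' ∧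
        operandVarSet (gateVarSets gs) u ⊆ rowsLT n j ×ˢ (Finset.univ : Finset (Fin n))) :
    ∃ gs' : List (Gate R (Fin n × Fin n)), gs <+: gs' ∧
      (∀ g ∈ gs', g.fanIn ≤ 2 ∧ IsPlainGate g) ∧
      (∀ (i : ℕ) (args : List (Operand R (Fin n × Fin n))),
        gs'[i]? = some (.prod args) →
        (args.map (operandVarSet (gateVarSets (gs'.take i)))).Pairwise Disjoint) ∧
      gs'.length ≤ gs.length + 2 * (j + 1) ∧
      ∃ u : Operand R (Fin n × Fin n), u.RefsBelow gs'.length ∧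
        u.eval (gateValues gs') = subperm R n (j + 1) S' ∧
        operandVarSet (gateVarSets gs') u ⊆ rowsLT n (j + 1) ×ˢ (Finset.univ : Finset (Fin n)) := by
  classical
  set p₀ : Fin n := ⟨j, hj⟩ with hp₀def
  set V := rowsLT n (j + 1) ×ˢ (Finset.univ : Finset (Fin n)) with hVdef
  set t : Fin n → MvPolynomial (Fin n × Fin n) R := fun c =>
    X (p₀, c) * subperm R n j (S'.erase c) with htdef
  have hrec := subperm_succ (R := R) hj S'
  have hsum : (S'.toList.map t).sum = ∑ c ∈ S', t c := Finset.sum_map_toList S' t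
  obtain ⟨gs', hp', hg', hm', hl', u, hu, hue, huV⟩ := savail_list_sum t V 1 S'.toList gs hgs hml (by
    intro c hc gs₁ hp₁ hg₁ hm₁
    rw [Finset.mem_toList] at hc
    have hcard : (S'.erase c).card = j := by rw [Finset.card_erase_of_mem hc, hS']; rfl
    obtain ⟨gs₂, hp₂, hg₂, hm₂, hl₂, hx⟩ := sextend_mul hg₁ hm₁
      (V₁ := ({p₀} : Finset (Fin n)) ×ˢ (Finset.univ : Finset (Fin n)))
      (V₂ := rowsLT n j ×ˢ (Finset.univ : Finset (Fin n)))
      (by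
        rw [Finset.disjoint_product, Finset.disjoint_singleton_left]
        exact Or.inl (not_mem_rowsLT hj))
      (savail_X gs₁ (p₀, c) (by simp))
      (savail_mono hp₁ (havail (S'.erase c) hcard))
    refine ⟨gs₂, hp₂, hg₂, hm₂, hl₂, savail_weaken ?_ hx⟩
    rw [hVdef]
    refine Finset.union_subset ?_ (rowsLT_prod_mono (Nat.le_succ j))
    refine Finset.product_subset_product_left ?_
    rw [Finset.singleton_subset_iff]
    exact mem_rowsLT_succ hj)
  refine ⟨gs', hp', hg', hm', ?_, u, hu, ?_, huV⟩
  · rw [Finset.length_toList, hS'] at hl'; omega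
  · rw [hue, hsum, hrec]

/-- **One stage.** From all `q(j, ·)` (every `j`-set) to all `q(j+1, ·)`: at most
`2 (j+1) · C(n, j+1)` gates. [cite: RazYehudayoff2008, §2] -/
theorem stage (n : ℕ) {j : ℕ} (hj : j < n) (gs : List (Gate R (Fin n × Fin n)))
    (hgs : ∀ g ∈ gs, g.fanIn ≤ 2 ∧ IsPlainGate g)
    (hml : ∀ (i : ℕ) (args : List (Operand R (Fin n × Fin n))),
      gs[i]? = some (.prod args) →
      (args.map (operandVarSet (gateVarSets (gs.take i)))).Pairwise Disjoint)
    (havail : ∀ S'' : Finset (Fin n), S''.card = j →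
      ∃ u : Operand R (Fin n × Fin n), u.RefsBelow gs.length ∧
        u.eval (gateValues gs) = subperm R n j S'' ∧
        operandVarSet (gateVarSets gs) u ⊆ rowsLT n j ×ˢ (Finset.univ : Finset (Fin n))) :
    ∃ gs' : List (Gate R (Fin n × Fin n)), gs <+: gs' ∧
      (∀ g ∈ gs', g.fanIn ≤ 2 ∧ IsPlainGate g) ∧
      (∀ (i : ℕ) (args : List (Operand R (Fin n × Fin n))),
        gs'[i]? = some (.prod args) →
        (args.map (operandVarSet (gateVarSets (gs'.take i)))).Pairwise Disjoint) ∧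
      gs'.length ≤ gs.length +
        2 * (j + 1) * ((Finset.univ : Finset (Fin n)).powersetCard (j + 1)).card ∧
      ∀ S' : Finset (Fin n), S'.card = j + 1 →
        ∃ u : Operand R (Fin n × Fin n), u.RefsBelow gs'.length ∧
          u.eval (gateValues gs') = subperm R n (j + 1) S' ∧
          operandVarSet (gateVarSets gs') u ⊆ rowsLT n (j + 1) ×ˢ (Finset.univ : Finset (Fin n)) := by
  classical
  set L := ((Finset.univ : Finset (Fin n)).powersetCard (j + 1)).toList with hLdef
  obtain ⟨gs', hp', hg', hm', hl', hQ⟩ := siterate_extend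
    (Q := fun l gs' =>
      ∃ u : Operand R (Fin n × Fin n), u.RefsBelow gs'.length ∧
        u.eval (gateValues gs') = subperm R n (j + 1) (L.getD l ∅) ∧
        operandVarSet (gateVarSets gs') u ⊆ rowsLT n (j + 1) ×ˢ (Finset.univ : Finset (Fin n)))
    (fun l gs₁ gs₂ h hQ => savail_mono h hQ) (2 * (j + 1)) gs hgs hml L.length (by
      intro l hl gs₁ hp₁ hg₁ hm₁ _
      have hmem : L.getD l ∅ ∈ (Finset.univ : Finset (Fin n)).powersetCard (j + 1) := by
        rw [← Finset.mem_toList, ← hLdef, List.getD_eq_getElem?_getD, List.getElem?_eq_getElem hl,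
          Option.getD_some]
        exact List.getElem_mem hl
      have hcard : (L.getD l ∅).card = j + 1 := (Finset.mem_powersetCard.mp hmem).2
      obtain ⟨gsa, hpa, hga, hma, hla, hua⟩ := entry n hj (L.getD l ∅) hcard gs₁ hg₁ hm₁
        (fun S'' hS'' => savail_mono hp₁ (havail S'' hS''))
      exact ⟨gsa, hpa, hga, hma, hla, hua⟩)
  refine ⟨gs', hp', hg', hm', ?_, ?_⟩
  · rw [hLdef, Finset.length_toList] at hl'
    exact hl'
  · intro S' hS'
    have hmem : S' ∈ L := by
      rw [hLdef, Finset.mem_toList, Finset.mem_powersetCard]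
      exact ⟨Finset.subset_univ _, hS'⟩
    obtain ⟨l, hl, hlS⟩ := List.getElem_of_mem hmem
    have hget : L.getD l ∅ = S' := by
      rw [List.getD_eq_getElem?_getD, List.getElem?_eq_getElem hl, Option.getD_some, hlS]
    have := hQ l hl
    rw [hget] at this
    exact this

/-- **All stages.** For every `j ≤ n`: one plain, fan-in-two, syntactically multilinear gate list of
at most `2 (n+1) · Σ_{i ≤ j} C(n, i)` gates in which every `q(j, S)`, `|S| = j`, is available with
support in the first `j` rows. [cite: RazYehudayoff2008, §2] -/
theorem tablesDP (n : ℕ) : ∀ j ≤ n,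
    ∃ gs : List (Gate R (Fin n × Fin n)),
      (∀ g ∈ gs, g.fanIn ≤ 2 ∧ IsPlainGate g) ∧
      (∀ (i : ℕ) (args : List (Operand R (Fin n × Fin n))),
        gs[i]? = some (.prod args) →
        (args.map (operandVarSet (gateVarSets (gs.take i)))).Pairwise Disjoint) ∧
      gs.length ≤ 2 * (n + 1) * ∑ i ∈ Finset.range (j + 1), Nat.choose n i ∧
      ∀ S : Finset (Fin n), S.card = j →
        ∃ u : Operand R (Fin n × Fin n), u.RefsBelow gs.length ∧
          u.eval (gateValues gs) = subperm R n j S ∧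
          operandVarSet (gateVarSets gs) u ⊆ rowsLT n j ×ˢ (Finset.univ : Finset (Fin n)) := by
  classical
  intro j
  induction j with
  | zero =>
    intro _
    refine ⟨[], by simp, prodInv_nil, by simp, ?_⟩
    intro S hS
    rw [Finset.card_eq_zero] at hS
    subst hS
    have h := savail_C (σ := Fin n × Fin n) ([] : List (Gate R _)) (1 : R)
      (rowsLT n 0 ×ˢ (Finset.univ : Finset (Fin n)))
    rw [C_1, ← subperm_zero (R := R) n] at h
    exact h
  | succ j ih =>
    intro hjn
    obtain ⟨gs, hgs, hml, hlen, hav⟩ := ih (Nat.le_of_succ_le hjn)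
    obtain ⟨gs', -, hg', hm', hl', hav'⟩ := stage n (Nat.lt_of_succ_le hjn) gs hgs hml hav
    refine ⟨gs', hg', hm', ?_, hav'⟩
    have hc : ((Finset.univ : Finset (Fin n)).powersetCard (j + 1)).card = Nat.choose n (j + 1) := by
      rw [Finset.card_powersetCard, Finset.card_univ, Fintype.card_fin]
    have h1 : 2 * (j + 1) * ((Finset.univ : Finset (Fin n)).powersetCard (j + 1)).card ≤
        2 * (n + 1) * Nat.choose n (j + 1) := by
      rw [hc]; exact Nat.mul_le_mul_right _ (Nat.mul_le_mul_left _ (by omega))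
    rw [Finset.sum_range_succ, Nat.mul_add]
    calc gs'.length ≤ gs.length + 2 * (j + 1) *
          ((Finset.univ : Finset (Fin n)).powersetCard (j + 1)).card := hl'
      _ ≤ 2 * (n + 1) * ∑ i ∈ Finset.range (j + 1), Nat.choose n i +
          2 * (n + 1) * Nat.choose n (j + 1) := Nat.add_le_add hlen h1

/-! ### The circuit and the two refuted rungs of the threshold dial -/

/-- **The column-subset DP as a circuit.** `per_n` has a fan-in-two syntactically multilinear circuit
of size `≤ 2 (n+1) 2^n`. [cite: Ryser1963, Ch. 2 §5] [cite: RazYehudayoff2008, §2] -/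
theorem exists_smCircuit_perPoly_dp (n : ℕ) :
    ∃ P : ArithCircuit R (Fin n × Fin n), P.IsFanInTwo ∧ IsSyntacticallyMultilinear P ∧
      P.Computes (perPoly (Fin n) R) ∧ P.size ≤ 2 * (n + 1) * 2 ^ n := by
  classical
  obtain ⟨gs, hg, hm, hlen, hav⟩ := tablesDP (R := R) n n le_rfl
  obtain ⟨u, -, hue, -⟩ := hav Finset.univ (by rw [Finset.card_univ, Fintype.card_fin])
  refine ⟨⟨gs, u⟩, fun g hg' => (hg g hg').1, isSyntacticallyMultilinear_of_prodInv hm u, ?_, ?_⟩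
  · change u.eval (gateValues gs) = perPoly (Fin n) R
    rw [hue, subperm_full]
  · change gs.length ≤ 2 * (n + 1) * 2 ^ n
    rw [← Nat.sum_range_choose n]
    exact hlen

/-- In `ℕ∞`: `smCircuitSize per_n ≤ 2 (n+1) 2^n`. [cite: Ryser1963, Ch. 2 §5] [cite: RazYehudayoff2008, §2] -/
theorem smCircuitSize_perPoly_le_dp (n : ℕ) :
    smCircuitSize (perPoly (Fin n) R) ≤ (2 * (n + 1) * 2 ^ n : ℕ) := by
  obtain ⟨P, h2, hsm, hf, hs⟩ := exists_smCircuit_perPoly_dp (R := R) n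
  exact (smCircuitSize_le h2 hsm hf).trans (by exact_mod_cast hs)

/-- **Rung `c = 1` of the threshold dial is FALSE** — literally `¬ Theorems.SmThreshold.PerSmHardExp 1`
(stated unfolded; that file is a theses-cone leaf and re-derives the named form by `Iff.rfl`):
`per_m` has syntactically multilinear circuits of size `2(m+1)2^m ≤ 2(m+1)^2·4^m`. [cite: Ryser1963, Ch. 2 §5] -/
theorem not_perSmHardExp_one :
    ¬ (∀ a : ℕ, ∃ m : ℕ, ∀ P : ArithCircuit ℂ (Fin (m * 1) × Fin (m * 1)), P.IsFanInTwo →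
        IsSyntacticallyMultilinear P → P.Computes (perPoly (Fin (m * 1)) ℂ) →
        a * (m + 1) ^ a * 4 ^ m < P.size) := by
  intro h
  obtain ⟨m, hm⟩ := h 2
  obtain ⟨P, h2, hsm, hf, hs⟩ := exists_smCircuit_perPoly_dp (R := ℂ) (m * 1)
  have hlt := hm P h2 hsm hf
  have hs' : P.size ≤ 2 * (m + 1) * 2 ^ m := by simpa only [Nat.mul_one] using hs
  have h24 : (2 : ℕ) ^ m ≤ 4 ^ m := Nat.pow_le_pow_left (by norm_num) m
  have hsq : m + 1 ≤ (m + 1) ^ 2 := by nlinarith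
  have hle : P.size ≤ 2 * (m + 1) ^ 2 * 4 ^ m :=
    hs'.trans (Nat.mul_le_mul (Nat.mul_le_mul_left _ hsq) h24)
  omega

/-- **Rung `c = 2` of the threshold dial is FALSE** — literally `¬ Theorems.SmThreshold.PerSmHardExp 2`:
`per_(2m)` has syntactically multilinear circuits of size `2(2m+1)·4^m ≤ 4(m+1)^4·4^m`.
[cite: Ryser1963, Ch. 2 §5] -/
theorem not_perSmHardExp_two :
    ¬ (∀ a : ℕ, ∃ m : ℕ, ∀ P : ArithCircuit ℂ (Fin (m * 2) × Fin (m * 2)), P.IsFanInTwo →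
        IsSyntacticallyMultilinear P → P.Computes (perPoly (Fin (m * 2)) ℂ) →
        a * (m + 1) ^ a * 4 ^ m < P.size) := by
  intro h
  obtain ⟨m, hm⟩ := h 4
  obtain ⟨P, h2, hsm, hf, hs⟩ := exists_smCircuit_perPoly_dp (R := ℂ) (m * 2)
  have hlt := hm P h2 hsm hf
  have h24 : (2 : ℕ) ^ (m * 2) = 4 ^ m := by
    rw [Nat.mul_comm, Nat.pow_mul]
  have hle : P.size ≤ 4 * (m + 1) ^ 4 * 4 ^ m := by
    calc P.size ≤ 2 * (m * 2 + 1) * 2 ^ (m * 2) := hs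
      _ ≤ 4 * (m + 1) ^ 4 * 4 ^ m := by
          rw [h24]
          refine Nat.mul_le_mul_right _ ?_
          have h1 : 1 ≤ (m + 1) ^ 3 := Nat.one_le_pow _ _ (Nat.succ_pos m)
          calc 2 * (m * 2 + 1) ≤ 4 * (m + 1) := by omega
            _ = 4 * (m + 1) * 1 := (Nat.mul_one _).symm
            _ ≤ 4 * (m + 1) * (m + 1) ^ 3 := Nat.mul_le_mul_left _ h1
            _ = 4 * (m + 1) ^ 4 := by ring
  omega

end Summit.ValiantsHypothesis.ValiantsHypothesis.Theorems.ColumnSubsetDP
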